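import Mathlib.Analysis.Complex.Basic
import Mathlib.Data.Complex.BigOperators
import HarnessLib

/-!
# The homogeneous Chebyshev kernels on `ℝ²` are positive semidefinite (Schoenberg, `S¹` case)

The `μ = 0` companion of `Literature.Analysis.SpecialFunctions.sum_mul_gegenbauerHom_nonneg`
(which needs `μ = (n-2)/2 > 0`, i.e. `ℝⁿ` with `n ≥ 3`): on `ℝ² ≅ ℂ` the bivariate homogeneous
Chebyshev kernel `T^{hom}_k(2⟨x, y⟩, |x|²|y|²) = |x|^k |y|^k T_k(cos ∠(x, y)) = Re((x̄y)^k)` satisfies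
`Σ_{i,j} c_i c_j T^{hom}_k(2⟨x_i,x_j⟩, |x_i|²|x_j|²) = |Σ_j c_j x_j^k|² ≥ 0` for ALL vectors
`x_i ∈ ℝ²` (zero allowed) and real weights. This is the inner (hyperplane) positivity needed for the
Bachoc–Vallentin three-point bound on `S²` (J. AMS 21 (2008), Thm 3.2 / Cor. 3.5 with `n = 3`,
`P_k^{n-1} = T_k`), in the same homogeneous normalisation as the tree's `BachocVallentin.Q n k`.

* `chebHom k a w` — the polynomial with `chebHom k (z + z̄) (z z̄) = Re… = (z^k + z̄^k)/2`:
  `chebHom 0 = 1`, `chebHom 1 a w = a/2`, `chebHom (k+2) a w = a · chebHom (k+1) a w - w · chebHom k a w`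
  (so `chebHom k (2 cos θ) 1 = T_k(cos θ) = cos kθ`);
* `chebHom_two_re_eq` — `chebHom k (2 Re(z̄ w)) (|z|²|w|²) = Re(z̄^k w^k)`;
* `sum_mul_chebHom_nonneg` — **Schoenberg positivity on `ℝ²`** for the homogeneous kernels.
[cite: Schoenberg1942, Theorem 1 (the circle)]; [cite: BachocVallentin2007, Corollary 3.5 (n = 3)].
-/

noncomputable section

open Finset Complex
open scoped ComplexConjugate

namespace Literature.Analysis.SpecialFunctions

/-- The bivariate homogeneous Chebyshev polynomial: `chebHom k (z + z̄) (z z̄) = (z^k + z̄^k)/2`,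
equivalently `chebHom k (2⟨x,y⟩) (|x|²|y|²) = |x|^k|y|^k T_k(cos ∠(x,y))` on `ℝ²`.
[cite: BachocVallentin2007, Theorem 3.2 (the kernel Q_k^{n-1} for n = 3: P_k^{2} = T_k)] -/
def chebHom : ℕ → ℝ → ℝ → ℝ
  | 0, _, _ => 1
  | 1, a, _ => a / 2
  | k + 2, a, w => a * chebHom (k + 1) a w - w * chebHom k a w

/-- `chebHom 0 = 1`. [folklore] -/
@[simp] private theorem chebHom_zero (a w : ℝ) : chebHom 0 a w = 1 := rfl
/-- `chebHom 1 a w = a/2`. [folklore] -/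
@[simp] private theorem chebHom_one (a w : ℝ) : chebHom 1 a w = a / 2 := rfl
/-- The three-term (Lucas/Chebyshev) recursion. [folklore] -/
private theorem chebHom_add_two (k : ℕ) (a w : ℝ) :
    chebHom (k + 2) a w = a * chebHom (k + 1) a w - w * chebHom k a w := rfl

/-- `chebHom k (2 Re(z̄ w)) (|z|² |w|²) = Re(z̄^k w^k)` — the kernel is the real part of a
product of powers (Lucas recursion for `ζ^k + ζ̄^k`, `ζ = z̄ w`). [folklore] -/
private theorem chebHom_two_re_eq (k : ℕ) (z w : ℂ) :
    (chebHom k (2 * (conj z * w).re) (normSq z * normSq w) : ℝ) = ((conj z) ^ k * w ^ k).re := by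
  -- ζ = z̄ w;  ζ + ζ̄ = 2 Re ζ,  ζ ζ̄ = |ζ|² = |z|²|w|²
  set ζ : ℂ := conj z * w with hζ
  have hw : normSq z * normSq w = normSq ζ := by rw [hζ, normSq_mul, normSq_conj]
  rw [hw, show (conj z) ^ k * w ^ k = ζ ^ k by rw [hζ, mul_pow]]
  -- two-step induction on k
  induction k using Nat.twoStepInduction with
  | zero => simp
  | one => simp
  | more k ih0 ih1 =>
    rw [chebHom_add_two, ih0, ih1]
    -- Re(ζ^{k+2}) = 2 Re ζ · Re(ζ^{k+1}) - |ζ|² Re(ζ^k): from ζ^{k+2} = (ζ + ζ̄) ζ^{k+1} - ζ ζ̄ ζ^k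
    have hid : ζ ^ (k + 2) = ((ζ + conj ζ) * ζ ^ (k + 1) - (ζ * conj ζ) * ζ ^ k) := by ring
    have hre1 : ((ζ + conj ζ) * ζ ^ (k + 1)).re = 2 * ζ.re * (ζ ^ (k + 1)).re := by
      have : ζ + conj ζ = ((2 * ζ.re : ℝ) : ℂ) := by
        rw [Complex.add_conj]
      rw [this, Complex.re_ofReal_mul]
    have hre2 : ((ζ * conj ζ) * ζ ^ k).re = normSq ζ * (ζ ^ k).re := by
      rw [Complex.mul_conj, Complex.re_ofReal_mul]
    rw [hid, Complex.sub_re, hre1, hre2]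

/-- **Schoenberg positivity on `ℝ²` (homogeneous Chebyshev kernels).** For any vectors
`x_i ∈ ℝ²` — given as complex numbers `z_i` — and real weights `c_i`:
`0 ≤ Σ_{i,j ∈ s} c_i c_j · chebHom k (2 Re(z̄_i z_j)) (|z_i|² |z_j|²)`; indeed the sum equals
`|Σ_j c_j z_j^k|²`. Here `2 Re(z̄_i z_j) = 2⟨x_i, x_j⟩` and `|z_i|²|z_j|² = |x_i|²|x_j|²`.
[cite: Schoenberg1942, Theorem 1 (the case of the circle)] -/
theorem sum_mul_chebHom_nonneg {ι : Type*} (s : Finset ι) (k : ℕ) (z : ι → ℂ) (c : ι → ℝ) :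
    0 ≤ ∑ i ∈ s, ∑ j ∈ s, c i * c j * chebHom k (2 * (conj (z i) * z j).re) (normSq (z i) * normSq (z j)) := by
  have hterm : ∀ i j, c i * c j * chebHom k (2 * (conj (z i) * z j).re) (normSq (z i) * normSq (z j))
      = ((conj ((c i : ℂ) * z i ^ k)) * ((c j : ℂ) * z j ^ k)).re := by
    intro i j
    rw [chebHom_two_re_eq, map_mul, Complex.conj_ofReal, map_pow]
    have : conj (z i) ^ k * z j ^ k * ((c i : ℂ) * (c j : ℂ)) =
        (c i : ℂ) * conj (z i) ^ k * ((c j : ℂ) * z j ^ k) := by ring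
    rw [← this, show ((c i : ℂ) * (c j : ℂ)) = ((c i * c j : ℝ) : ℂ) by push_cast; ring,
      Complex.re_mul_ofReal]
    ring
  simp_rw [hterm]
  set S : ℂ := ∑ j ∈ s, (c j : ℂ) * z j ^ k with hS
  have hsum : (∑ i ∈ s, ∑ j ∈ s, (conj ((c i : ℂ) * z i ^ k) * ((c j : ℂ) * z j ^ k)).re)
      = (conj S * S).re := by
    rw [hS, map_sum, Finset.sum_mul, Complex.re_sum]
    refine Finset.sum_congr rfl fun i _ => ?_
    rw [Finset.mul_sum, Complex.re_sum]
  rw [hsum, ← normSq_eq_conj_mul_self, Complex.ofReal_re]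
  exact normSq_nonneg S

end Literature.Analysis.SpecialFunctions
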